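import Literature.Geometry.Riemannian.GurskyViaclovskyBackgroundNaturality
import HarnessLib

/-!
# Gursky–Viaclovsky: frame expansion and naturality of the background operator for `C²` functions

Support file (everything PROVED; no definition, no named fact) for the Gursky–Viaclovsky
continuity method behind `Literature.Geometry.Riemannian.gurskyViaclovsky_pathClosed_weighted_four`
and its openness companion. The frame expansion `backgroundPathOperator_eq_frame` /
`backgroundPathOperator_eq_framePoly` (Limit and Ellipticity files) and the naturality
`backgroundPathOperator_comap` (BackgroundNaturality file) are stated there for SMOOTH `w`, but
the background operator `backgroundPathOperator g t w x` is a polynomial in the `2`-jet of `w` at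
`x` with the curvature data of `g` as coefficients, and the landed proofs use `w ∈ C²` at the
point only (through the symmetry of the Hessian, `hessian_symm_holds`, and the naturality of the
Hessian, `hessian_comap_apply`, both already stated for `C²` functions). The openness half of the
continuity method (the implicit function theorem in `C^{2,α}`) and the regularity bootstrap work
with `C^{2,α}` functions, which are `C²` but not `C^∞`; this file re-proves the two statements
under the hypothesis "`C²` at the point":

* `backgroundPathOperator_eq_frame_of_contMDiffAt_two`,
  `backgroundPathOperator_eq_framePoly_of_contMDiffAt_two` — the background operator in a
  `g`-orthonormal frame is the frame polynomial `𝒫_t` of the frame `2`-jet;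
* `backgroundPathOperator_comap_of_contMDiffAt_two` — naturality under equidimensional isometric
  immersions `Φ : N → M` for `w` of class `C²` at `Φ y`.

The chart form of the equation for `C²` functions is in `GurskyViaclovskyChartEquationC2.lean`.
Nothing here is new mathematics: statements and proofs are the landed ones with
`ContMDiff … ∞ w` replaced by `ContMDiffAt … 2 w x`.

## References

* M. J. Gursky, J. A. Viaclovsky, J. Differential Geom. 63 (2003) 131–154, §1 (change1)–(PDE),
  Prop. 6. [GurskyViaclovsky2003]
* B. O'Neill, *Semi-Riemannian Geometry* (1983), Ch. 3, pp. 90–91. [ONeill1983]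
-/

noncomputable section

open scoped Manifold ContDiff Topology
open Set Function Module Finset

namespace Literature.Geometry.Riemannian.GurskyViaclovskyPath

open Literature.Geometry.Lorentzian (PseudoRiemannianMetric)
open Literature.Geometry.Lorentzian.PseudoRiemannianMetric
open Literature.Geometry.Lorentzian
open Literature.Geometry.Riemannian.GurskyViaclovsky

/-! ### The frame expansion for `C²` functions -/

section Frame

variable {M : Type*} [TopologicalSpace M] [ChartedSpace (EuclideanSpace ℝ (Fin 4)) M]
  [IsManifold (𝓡 4) ∞ M]
  (g : PseudoRiemannianMetric (𝓡 4) ∞ (EuclideanSpace ℝ (Fin 4)) (TangentSpace (𝓡 4) : M → Type _))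
  [g.HasLeviCivita]

/-- **`backgroundPathOperator` in a `g`-orthonormal frame, for `w` of class `C²` at `x`**: with
`H_{ab} = Hess_g w(e_a,e_b)`, `b_a = dw(e_a)`, `Ric_{ab}`, `R = R_g(x)`,
`backgroundPathOperator g t w x = σ₂(A_g)(x) + [2ΣRic_{ab}H_{ab} − RΣH_{aa}] + 2[(ΣH_{aa})² − ΣH_{ab}²
− ΣRic_{ab}b_ab_b] + 2[(ΣH_{aa})(Σb_a²) + 2ΣH_{ab}b_ab_b] − ¼|W_g|²(x) + (1−t)(2−t)(R − 6ΣH_{aa} − 6Σb_a²)²/6`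
(the statement of `backgroundPathOperator_eq_frame`, whose proof uses only the symmetry of the
Hessian of `w` at `x`). [cite: GurskyViaclovsky2003, §1 (change1)–(PDE)] -/
theorem backgroundPathOperator_eq_frame_of_contMDiffAt_two {w : M → ℝ} {x : M}
    (hw : ContMDiffAt (𝓡 4) 𝓘(ℝ) 2 w x) (t : ℝ) {e : Fin 4 → TangentSpace (𝓡 4) x}
    (he : g.IsOrthonormalFrame x e) :
    backgroundPathOperator g t w x =
      g.sigma2WeylSchouten x
      + (2 * ∑ a, ∑ b, g.ricci x (e a) (e b) * g.hessian w x (e a) (e b)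
          - g.scalarCurvature x * ∑ a, g.hessian w x (e a) (e a))
      + 2 * ((∑ a, g.hessian w x (e a) (e a)) ^ 2 - ∑ a, ∑ b, g.hessian w x (e a) (e b) ^ 2
          - ∑ a, ∑ b, g.ricci x (e a) (e b) * (mvfderiv (𝓡 4) w x (e a) * mvfderiv (𝓡 4) w x (e b)))
      + 2 * ((∑ a, g.hessian w x (e a) (e a)) * (∑ a, mvfderiv (𝓡 4) w x (e a) ^ 2)
          + 2 * ∑ a, ∑ b, g.hessian w x (e a) (e b) *
              (mvfderiv (𝓡 4) w x (e a) * mvfderiv (𝓡 4) w x (e b)))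
      - 1 / 4 * g.weylNormSq x
      + (1 - t) * (2 - t) * (g.scalarCurvature x - 6 * ∑ a, g.hessian w x (e a) (e a)
          - 6 * ∑ a, mvfderiv (𝓡 4) w x (e a) ^ 2) ^ 2 / 6 := by
  -- adapted from `backgroundPathOperator_eq_frame` (GurskyViaclovskyClosednessLimit.lean)
  classical
  have hE : finrank ℝ (EuclideanSpace ℝ (Fin 4)) = 4 := finrank_euclideanSpace_fin
  have hn2 : (2 : ℕ∞ω) ≤ ((⊤ : ℕ∞) : ℕ∞ω) := WithTop.coe_le_coe.mpr le_top
  have hι : Fintype.card (Fin 4) = finrank ℝ (EuclideanSpace ℝ (Fin 4)) := by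
    rw [Fintype.card_fin, hE]
  have hO : (g.toBilinForm x).IsOrthoᵢ (he.toBasis hι) := by
    intro i j hij
    rw [he.coe_toBasis hι]
    exact he.2 i j hij
  have hcne : ∀ i, g.val x (he.toBasis hι i) (he.toBasis hι i) ≠ 0 := fun i ↦ by
    rw [he.coe_toBasis hι, he.1 i]
    exact one_ne_zero
  unfold backgroundPathOperator
  set dw := (mvfderiv (𝓡 4) w x).toLinearMap with hdw
  have h1 : g.dalembertian w x = ∑ a, g.hessian w x (e a) (e a) :=
    dalembertian_eq_sum_orthonormalFrame g w he
  have h2 : g.normSq x (g.hessian w x) = ∑ a, ∑ b, g.hessian w x (e a) (e b) ^ 2 := by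
    rw [g.normSq_eq_sum_sq x (he.toBasis hι) hO hcne, Finset.sum_comm]
    simp only [he.coe_toBasis hι, he.1, mul_one, div_one]
  have hsharp : g.sharp x dw = ∑ i, dw (e i) • e i := by
    rw [g.sharp_eq_sum_of_isOrthoᵢ x (he.toBasis hι) hO hcne]
    simp only [he.coe_toBasis hι, he.1, div_one]
  have hRsym : ∀ a b, g.ricci x (e a) (e b) = g.ricci x (e b) (e a) := fun a b ↦
    (g.ricci_symm_holds hn2 x).eq (e a) (e b)
  have hHsym : ∀ a b, g.hessian w x (e a) (e b) = g.hessian w x (e b) (e a) := fun a b ↦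
    (g.hessian_symm_holds hw).eq (e a) (e b)
  have h3 : g.ricci x (g.sharp x dw) (g.sharp x dw) =
      ∑ a, ∑ b, g.ricci x (e a) (e b) * (dw (e a) * dw (e b)) := by
    rw [hsharp]
    simp only [map_sum, map_smul, LinearMap.sum_apply, LinearMap.smul_apply, smul_eq_mul,
      Finset.mul_sum]
    refine Finset.sum_congr rfl fun a _ ↦ Finset.sum_congr rfl fun b _ ↦ ?_
    rw [hRsym b a]
    ring
  have h4 : g.hessian w x (g.sharp x dw) (g.sharp x dw) =
      ∑ a, ∑ b, g.hessian w x (e a) (e b) * (dw (e a) * dw (e b)) := by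
    rw [hsharp]
    simp only [map_sum, map_smul, LinearMap.sum_apply, LinearMap.smul_apply, smul_eq_mul,
      Finset.mul_sum]
    refine Finset.sum_congr rfl fun a _ ↦ Finset.sum_congr rfl fun b _ ↦ ?_
    rw [hHsym b a]
    ring
  have h5 : g.gradSq w x = ∑ a, mvfderiv (𝓡 4) w x (e a) ^ 2 :=
    gradSq_eq_sum_orthonormalFrame g w he
  have h6 : g.innerBilin x (g.ricci x) (g.hessian w x) =
      ∑ a, ∑ b, g.ricci x (e a) (e b) * g.hessian w x (e a) (e b) := by
    rw [g.innerBilin_eq_sum_mul x (he.toBasis hι) hO hcne, Finset.sum_comm]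
    simp only [he.coe_toBasis hι, he.1, mul_one, div_one]
  have hdwe : ∀ a, dw (e a) = mvfderiv (𝓡 4) w x (e a) := fun a ↦ rfl
  simp only [hdwe] at h3 h4
  rw [h6, h1, h2, h3, h5, h4, backgroundScalar_eq_frame g w he]

/-- **The background operator is the frame polynomial of the frame `2`-jet**, for `w` of class
`C²` at the point (`backgroundPathOperator_eq_framePoly` with the smoothness hypothesis weakened).
[cite: GurskyViaclovsky2003, §1 (change1)–(PDE)] -/
theorem backgroundPathOperator_eq_framePoly_of_contMDiffAt_two {w : M → ℝ} {x : M}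
    (hw : ContMDiffAt (𝓡 4) 𝓘(ℝ) 2 w x) (t : ℝ)
    {e : Fin 4 → TangentSpace (𝓡 4) x} (he : g.IsOrthonormalFrame x e) :
    backgroundPathOperator g t w x =
      framePoly t (g.sigma2WeylSchouten x) (g.scalarCurvature x) (g.weylNormSq x)
        (fun a c ↦ g.ricci x (e a) (e c)) (fun a c ↦ g.hessian w x (e a) (e c))
        (fun a ↦ mvfderiv (𝓡 4) w x (e a)) := by
  rw [backgroundPathOperator_eq_frame_of_contMDiffAt_two g hw t he, framePoly]

end Frame

/-! ### Naturality under equidimensional isometric immersions, for `C²` functions -/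

section Naturality

variable {M : Type*} [TopologicalSpace M] [ChartedSpace (EuclideanSpace ℝ (Fin 4)) M]
  [IsManifold (𝓡 4) ∞ M]
  {N : Type*} [TopologicalSpace N] [ChartedSpace (EuclideanSpace ℝ (Fin 4)) N]
  [IsManifold (𝓡 4) ∞ N]
  (g : PseudoRiemannianMetric (𝓡 4) ∞ (EuclideanSpace ℝ (Fin 4)) (TangentSpace (𝓡 4) : M → Type _))
  [g.HasLeviCivita]
  {Φ : N → M} (hpb : contMDiff_pullbackBilin (𝓡 4) M (𝓡 4) N ∞)
  (hΦ : ContMDiff (𝓡 4) (𝓡 4) (∞ + 1) Φ)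
  (hΦ' : ∀ y, Function.Injective (mfderiv (𝓡 4) (𝓡 4) Φ y))
  (hdim : finrank ℝ (EuclideanSpace ℝ (Fin 4)) = finrank ℝ (EuclideanSpace ℝ (Fin 4)))
  [(g.comap hpb Φ hΦ hΦ' hdim).HasLeviCivita]

/-- **Naturality of the background operator, for `w` of class `C²` at `Φ y`**:
`backgroundPathOperator (Φ^*g) t (w ∘ Φ) y = backgroundPathOperator g t w (Φ y)` for an
equidimensional immersion `Φ` of `4`-manifolds and a Riemannian `g` — both sides are the frame
polynomial `𝒫_t` of corresponding frame data (`backgroundPathOperator_eq_framePoly_of_contMDiffAt_two`;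
Ricci, scalar curvature, `|W|²`, Hessians and differentials are natural). The statement of
`backgroundPathOperator_comap` with the smoothness hypothesis weakened.
[cite: ONeill1983, Ch. 3, pp. 90–91] -/
theorem backgroundPathOperator_comap_of_contMDiffAt_two (hg : g.IsRiemannian) {w : M → ℝ}
    (t : ℝ) (y : N) (hw : ContMDiffAt (𝓡 4) 𝓘(ℝ) 2 w (Φ y)) :
    backgroundPathOperator (g.comap hpb Φ hΦ hΦ' hdim) t (w ∘ Φ) y =
      backgroundPathOperator g t w (Φ y) := by
  -- adapted from `backgroundPathOperator_comap` (GurskyViaclovskyBackgroundNaturality.lean)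
  have hE : finrank ℝ (EuclideanSpace ℝ (Fin 4)) = 4 := finrank_euclideanSpace_fin
  have hn : (2 : ℕ∞ω) ≤ ((⊤ : ℕ∞) : ℕ∞ω) := WithTop.coe_le_coe.mpr le_top
  have hinv := isInvertible_mfderiv_of_injective (Φ := Φ) hdim (hΦ' y)
  obtain ⟨b, hb⟩ := g.exists_basis_isOrthonormalFrame (x := Φ y) (fun v hv ↦ hg _ v hv) hE
  set e : Fin 4 → TangentSpace (𝓡 4) y := fun i ↦ (mfderiv (𝓡 4) (𝓡 4) Φ y).inverse (b i)
    with he_def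
  have hde : ∀ i, mfderiv (𝓡 4) (𝓡 4) Φ y (e i) = b i := fun i ↦ hinv.self_apply_inverse (b i)
  have he : (g.comap hpb Φ hΦ hΦ' hdim).IsOrthonormalFrame y e := by
    rw [g.isOrthonormalFrame_comap_iff hpb hΦ hΦ' hdim]
    simp only [hde]
    exact hb
  have hwΦ : ContMDiffAt (𝓡 4) 𝓘(ℝ) 2 (w ∘ Φ) y :=
    hw.comp y ((hΦ.of_le (hn.trans le_self_add)) y)
  have hwd : MDifferentiableAt (𝓡 4) 𝓘(ℝ, ℝ) w (Φ y) := hw.mdifferentiableAt (by simp)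
  have hΦd : MDifferentiableAt (𝓡 4) (𝓡 4) Φ y :=
    ((hΦ.of_le le_self_add) y).mdifferentiableAt (by simp)
  have hRic : ∀ a c, (g.comap hpb Φ hΦ hΦ' hdim).ricci y (e a) (e c) =
      g.ricci (Φ y) (b a) (b c) := fun a c ↦ by
    rw [g.ricci_comap_apply_cn hpb hΦ hΦ' hdim hn y (e a) (e c), hde, hde]
  have hHess : ∀ a c, (g.comap hpb Φ hΦ hΦ' hdim).hessian (w ∘ Φ) y (e a) (e c) =
      g.hessian w (Φ y) (b a) (b c) := fun a c ↦ by
    rw [g.hessian_comap_apply hpb hΦ hΦ' hdim hw (e a) (e c), hde, hde]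
  have hd : ∀ a, mvfderiv (𝓡 4) (w ∘ Φ) y (e a) = mvfderiv (𝓡 4) w (Φ y) (b a) := fun a ↦ by
    rw [mvfderiv_comp_apply hwd hΦd, hde]
  -- the pull-back metric is Riemannian
  have hg' : (g.comap hpb Φ hΦ hΦ' hdim).IsRiemannian := fun u v hv ↦ by
    rw [val_comap, pullbackBilin_apply]
    exact hg _ _ fun h0 ↦ hv ((hΦ' u) (by
      rw [h0]; exact ((mfderiv (𝓡 4) (𝓡 4) Φ u).map_zero).symm))
  rw [backgroundPathOperator_eq_framePoly_of_contMDiffAt_two _ hwΦ t he,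
    backgroundPathOperator_eq_framePoly_of_contMDiffAt_two g hw t hb,
    sigma2WeylSchouten_eq_sigma2_frame _ hg' he, sigma2WeylSchouten_eq_sigma2_frame g hg hb,
    g.scalarCurvature_comap_cn hpb hΦ hΦ' hdim hn y, g.weylNormSq_comap hpb hΦ hΦ' hdim hg y]
  simp only [hRic, hHess, hd]

end Naturality

end Literature.Geometry.Riemannian.GurskyViaclovskyPath

end
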